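import Mathlib
import Literature.Analysis.SpecialFunctions.GaussLegendreQuadrature

/-!
# Geometric convergence of Gauss–Legendre quadrature for analytic integrands

**Theorem** [cite: Trefethen2008, Thm. 4.5 (4.14)] (Trefethen writes the rule with `n + 1` nodes;
here `n` is the number of nodes, as in `Literature.Analysis.SpecialFunctions.gaussLegendreNodes`):
let `f` be analytic in the open Bernstein ellipse `E_ρ` — foci `±1`, semi-axis sum `ρ > 1`, i.e.
`E_ρ = {z : |z - 1| + |z + 1| < ρ + ρ⁻¹}` — with `|f(z)| ≤ M` there.  Then the `n`-point
Gauss–Legendre rule `I_n = Σ_x w_x f(x)` satisfies, for every `n ≥ 1`,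

  `|∫_{-1}^{1} f - I_n| ≤ 8 M / ((ρ - 1) ρ^{2n-1})`,

and on a general interval `[a, b]` (foci `a`, `b`, semi-axis sum `ρ (b-a)/2`) the same bound times
`(b - a)/2` (`norm_integral_sub_gaussLegendre_le_interval`).

The constant `8` is the one obtained in the "partial proof" printed with Theorem 4.5 (from
`|a_k| ≤ 2Mρ^{-k}`, Thm. 4.2 (4.7), exactness on `T_k` for `k ≤ 2n - 1`, and
`|∫ T_k - Σ w_x T_k(x)| ≤ 2 + 2`); Trefethen's sharper `64/15` (using `|∫_{-1}^{1} T_k| ≤ 2/(k²-1)`)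
is not formalised here.  The Chebyshev series of `f` is realised as the Fourier series of the even
`2π`-periodic function `f (cos θ)`, analytic in the strip `|Im θ| < log ρ` ((4.4)–(4.7) loc. cit.);
its coefficients are bounded by shifting the contour to `Im θ = ∓a'`, `a' < log ρ` (Mathlib's
rectangle form of Cauchy's theorem), the series is integrated termwise against the quadrature error
functional (dominated convergence), and the two geometric tails `|k| ≥ 2n` are summed.

## References

* L. N. Trefethen, *Is Gauss quadrature better than Clenshaw–Curtis?*, SIAM Review 50 (2008)
  67–87, Theorems 4.2 and 4.5, eqs. (4.4)–(4.7), (4.13)–(4.14).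
  [cite: Trefethen2008, Thm. 4.5 (4.14)]

AI-produced formalisation (H21 engines group, seat eng-cap-1, 2026-08-20); no facts, no axioms
beyond Mathlib's, no `sorry`.
-/

open Complex Set MeasureTheory Filter Topology

open scoped Real Interval

namespace Literature.Analysis.Quadrature

open Literature.Analysis.SpecialFunctions Polynomial.Chebyshev

/-- The open **Bernstein ellipse** region `E_ρ`: the open region bounded by the ellipse with foci
`±1` whose semi-major and semi-minor axis lengths sum to `ρ` (semi-major axis `(ρ + ρ⁻¹)/2`, so the
region is `|z - 1| + |z + 1| < ρ + ρ⁻¹`). [cite: Trefethen2008, Thm. 4.2] -/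
def bernsteinEllipse (ρ : ℝ) : Set ℂ := {z : ℂ | ‖z - 1‖ + ‖z + 1‖ < ρ + ρ⁻¹}

/-- `E_ρ` is open. [cite: Trefethen2008, Thm. 4.2] -/
theorem isOpen_bernsteinEllipse (ρ : ℝ) : IsOpen (bernsteinEllipse ρ) :=
  isOpen_lt (by fun_prop) continuous_const

/-- `|cos θ - 1| = cosh (Im θ) - cos (Re θ)`. [folklore] -/
private theorem norm_cos_sub_one (θ : ℂ) :
    ‖Complex.cos θ - 1‖ = Real.cosh θ.im - Real.cos θ.re := by
  have hθ : Complex.cos θ - 1 = ((Real.cos θ.re * Real.cosh θ.im - 1 : ℝ) : ℂ) +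
      ((-(Real.sin θ.re * Real.sinh θ.im) : ℝ) : ℂ) * I := by
    rw [Complex.cos_eq θ]
    push_cast
    ring
  have hnn : 0 ≤ Real.cosh θ.im - Real.cos θ.re := by
    linarith [Real.one_le_cosh θ.im, Real.cos_le_one θ.re]
  rw [hθ, Complex.norm_add_mul_I, ← Real.sqrt_sq hnn]
  congr 1
  have hs := Real.sin_sq_add_cos_sq θ.re
  have hc := Real.cosh_sq θ.im
  linear_combination (Real.sinh θ.im ^ 2) * hs + (Real.cos θ.re ^ 2 - 1) * hc

/-- `|cos θ + 1| = cosh (Im θ) + cos (Re θ)`. [folklore] -/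
private theorem norm_cos_add_one (θ : ℂ) :
    ‖Complex.cos θ + 1‖ = Real.cosh θ.im + Real.cos θ.re := by
  have hθ : Complex.cos θ + 1 = ((Real.cos θ.re * Real.cosh θ.im + 1 : ℝ) : ℂ) +
      ((-(Real.sin θ.re * Real.sinh θ.im) : ℝ) : ℂ) * I := by
    rw [Complex.cos_eq θ]
    push_cast
    ring
  have hnn : 0 ≤ Real.cosh θ.im + Real.cos θ.re := by
    linarith [Real.one_le_cosh θ.im, Real.neg_one_le_cos θ.re]
  rw [hθ, Complex.norm_add_mul_I, ← Real.sqrt_sq hnn]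
  congr 1
  have hs := Real.sin_sq_add_cos_sq θ.re
  have hc := Real.cosh_sq θ.im
  linear_combination (Real.sinh θ.im ^ 2) * hs + (Real.cos θ.re ^ 2 - 1) * hc

/-- The confocal ellipse through `cos θ` has semi-major axis `cosh (Im θ)`:
`|cos θ - 1| + |cos θ + 1| = 2 cosh (Im θ)`. [cite: Trefethen2008, Thm. 4.2] -/
theorem norm_cos_sub_one_add_norm_cos_add_one (θ : ℂ) :
    ‖Complex.cos θ - 1‖ + ‖Complex.cos θ + 1‖ = 2 * Real.cosh θ.im := by
  rw [norm_cos_sub_one, norm_cos_add_one]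
  ring

/-- `z = cos θ` maps the strip `|Im θ| < log ρ` onto `E_ρ`: `cos θ ∈ E_ρ ↔ |Im θ| < log ρ`
(`ρ > 1`).
[cite: Trefethen2008, Thm. 4.2] -/
theorem cos_mem_bernsteinEllipse_iff {ρ : ℝ} (hρ : 1 < ρ) (θ : ℂ) :
    Complex.cos θ ∈ bernsteinEllipse ρ ↔ |θ.im| < Real.log ρ := by
  have hρ0 : 0 < ρ := one_pos.trans hρ
  have key : Real.cosh θ.im < Real.cosh (Real.log ρ) ↔ |θ.im| < Real.log ρ := by
    rw [Real.cosh_lt_cosh, abs_of_pos (Real.log_pos hρ)]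
  rw [Real.cosh_log hρ0] at key
  rw [bernsteinEllipse, mem_setOf_eq, norm_cos_sub_one_add_norm_cos_add_one, ← key]
  constructor <;> intro h <;> linarith

/-- Every point of `E_ρ` is `cos θ` for some `θ` in the strip `|Im θ| < log ρ` (`ρ > 1`).
[cite: Trefethen2008, Thm. 4.2] -/
theorem mem_bernsteinEllipse_iff {ρ : ℝ} (hρ : 1 < ρ) (z : ℂ) :
    z ∈ bernsteinEllipse ρ ↔ ∃ θ : ℂ, |θ.im| < Real.log ρ ∧ Complex.cos θ = z := by
  constructor
  · intro hz
    obtain ⟨θ, rfl⟩ := Complex.cos_surjective z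
    exact ⟨θ, (cos_mem_bernsteinEllipse_iff hρ θ).mp hz, rfl⟩
  · rintro ⟨θ, hθ, rfl⟩
    exact (cos_mem_bernsteinEllipse_iff hρ θ).mpr hθ

/-- `[-1, 1] ⊆ E_ρ` for `ρ > 1`. [cite: Trefethen2008, Thm. 4.2] -/
theorem ofReal_mem_bernsteinEllipse {ρ : ℝ} (hρ : 1 < ρ) {t : ℝ} (ht : t ∈ Icc (-1 : ℝ) 1) :
    (t : ℂ) ∈ bernsteinEllipse ρ := by
  have hρ0 : 0 < ρ := one_pos.trans hρ
  have h1 : ‖(t : ℂ) - 1‖ = 1 - t := by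
    rw [show (t : ℂ) - 1 = ((t - 1 : ℝ) : ℂ) by push_cast; ring, Complex.norm_real,
      Real.norm_eq_abs, abs_of_nonpos (by linarith [ht.2])]
    ring
  have h2 : ‖(t : ℂ) + 1‖ = t + 1 := by
    rw [show (t : ℂ) + 1 = ((t + 1 : ℝ) : ℂ) by push_cast; ring, Complex.norm_real,
      Real.norm_eq_abs, abs_of_nonneg (by linarith [ht.1])]
  rw [bernsteinEllipse, mem_setOf_eq, h1, h2]
  have e : ρ + ρ⁻¹ - 2 = (ρ - 1) ^ 2 / ρ := by
    field_simp
    ring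
  have hpos : 0 < (ρ - 1) ^ 2 / ρ := div_pos (pow_pos (sub_pos.mpr hρ) 2) hρ0
  linarith

/-- Real part of the exponent `-(2πi n (x + σ i))/T`. [folklore] -/
private theorem re_exponent (n : ℤ) (x σ T : ℝ) :
    (-(2 * π * I * n * (x + σ * I) / T)).re = 2 * π * n * σ / T := by
  simp [Complex.div_ofReal_re]
  ring

/-- **Fourier coefficients of a periodic function analytic in a strip decay exponentially**
(contour shift; the vertical sides cancel by periodicity): if `f` is `T`-periodic, analytic in
`|Im z| < a` and bounded by `M` there, then for `0 ≤ a' < a` and every `n ∈ ℤ`,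
`‖∫_0^T e^{-2πi n x/T} f(x) dx‖ ≤ T M e^{-2π a' |n| / T}`. [folklore] -/
private theorem norm_integral_exp_mul_le {f : ℂ → ℂ} {T a M : ℝ} (hT : 0 < T)
    (hd : DifferentiableOn ℂ f {z : ℂ | |z.im| < a}) (hper : ∀ z : ℂ, f (z + T) = f z)
    (hM : ∀ z : ℂ, |z.im| < a → ‖f z‖ ≤ M) (n : ℤ) {a' : ℝ} (ha'0 : 0 ≤ a') (ha' : a' < a) :
    ‖∫ x in (0 : ℝ)..T, cexp (-(2 * π * I * n * x / T)) * f x‖ ≤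
      T * M * Real.exp (-(2 * π * a' * |(n : ℝ)| / T)) := by
  set g : ℂ → ℂ := fun z => cexp (-(2 * π * I * n * z / T)) * f z with hg
  have hTc : (T : ℂ) ≠ 0 := by exact_mod_cast hT.ne'
  -- `g` is `T`-periodic
  have hg_per : ∀ z, g (z + T) = g z := by
    intro z
    simp only [hg]
    rw [hper]
    congr 1
    have hsplit : (2 * π * I * n * (z + T) / T : ℂ) = 2 * π * I * n * z / T + 2 * π * I * n := by
      rw [mul_add, add_div, mul_div_assoc (2 * π * I * n) (T : ℂ) T, div_self hTc, mul_one]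
    rw [hsplit, show -(2 * π * I * n * z / T + 2 * π * I * n) =
      -(2 * π * I * n * z / T) + ((-n : ℤ) : ℂ) * (2 * π * I) by push_cast; ring]
    rw [Complex.exp_add, Complex.exp_eq_one_iff.mpr ⟨-n, rfl⟩, mul_one]
  -- `g` is analytic in the strip
  have hg_diff : DifferentiableOn ℂ g {z : ℂ | |z.im| < a} := by
    refine DifferentiableOn.mul (Differentiable.differentiableOn ?_) hd
    exact Complex.differentiable_exp.comp
      (((differentiable_const _).mul differentiable_id).div_const _).neg
  -- shifting the segment `[0, T]` vertically by `σ`, `|σ| < a`, does not change `∫ g`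
  have hshift : ∀ σ : ℝ, |σ| < a →
      ∫ x in (0 : ℝ)..T, g x = ∫ x in (0 : ℝ)..T, g (x + σ * I) := by
    intro σ hσ
    have hre : ((T : ℂ) + σ * I).re = T := by simp
    have him : ((T : ℂ) + σ * I).im = σ := by simp
    have H : DifferentiableOn ℂ g
        ([[(0 : ℂ).re, ((T : ℂ) + σ * I).re]] ×ℂ [[(0 : ℂ).im, ((T : ℂ) + σ * I).im]]) := by
      refine hg_diff.mono fun z hz => ?_
      rw [hre, him, Complex.zero_re, Complex.zero_im, mem_reProdIm] at hz
      have h2 := hz.2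
      rw [mem_uIcc] at h2
      show |z.im| < a
      rcases h2 with ⟨h1, h2⟩ | ⟨h1, h2⟩
      · rw [abs_of_nonneg h1]
        exact h2.trans_lt ((le_abs_self σ).trans_lt hσ)
      · rw [abs_of_nonpos h2]
        exact (neg_le_neg h1).trans_lt ((neg_le_abs σ).trans_lt hσ)
    have key := Complex.integral_boundary_rect_eq_zero_of_differentiableOn g 0 ((T : ℂ) + σ * I) H
    simp only [hre, him, Complex.zero_re, Complex.zero_im, ofReal_zero, zero_mul, add_zero,
      zero_add, smul_eq_mul] at key
    have hv : (∫ y in (0 : ℝ)..σ, g ((T : ℂ) + y * I)) = ∫ y in (0 : ℝ)..σ, g (y * I) :=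
      intervalIntegral.integral_congr fun y _ => by rw [add_comm, hg_per]
    rw [hv] at key
    linear_combination key
  -- pointwise bound on the shifted segment
  have hbound : ∀ σ : ℝ, |σ| < a → ∀ x : ℝ,
      ‖g (x + σ * I)‖ ≤ Real.exp (2 * π * n * σ / T) * M := by
    intro σ hσ x
    simp only [hg]
    rw [norm_mul, Complex.norm_exp, re_exponent]
    refine mul_le_mul_of_nonneg_left (hM _ ?_) (Real.exp_pos _).le
    simpa using hσ
  -- choose the sign of the shift according to the sign of `n`
  have main : ∀ σ : ℝ, |σ| < a → 2 * π * n * σ / T = -(2 * π * a' * |(n : ℝ)| / T) →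
      ‖∫ x in (0 : ℝ)..T, g x‖ ≤ T * M * Real.exp (-(2 * π * a' * |(n : ℝ)| / T)) := by
    intro σ hσ hexp
    rw [hshift σ hσ]
    have h := intervalIntegral.norm_integral_le_of_norm_le_const (a := (0 : ℝ)) (b := T)
      (f := fun x : ℝ => g (x + σ * I)) (C := Real.exp (2 * π * n * σ / T) * M)
      (fun x _ => hbound σ hσ x)
    rw [sub_zero, abs_of_pos hT, hexp] at h
    linarith [h]
  rcases le_or_gt 0 n with hn | hn
  · have habs : |(n : ℝ)| = n := abs_of_nonneg (by exact_mod_cast hn)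
    refine main (-a') (by rw [abs_neg, abs_of_nonneg ha'0]; exact ha') ?_
    rw [habs]
    ring
  · have habs : |(n : ℝ)| = -n := abs_of_neg (by exact_mod_cast hn)
    refine main a' (by rw [abs_of_nonneg ha'0]; exact ha') ?_
    rw [habs]
    ring



/-! ### The Gauss–Legendre error on Chebyshev polynomials -/

/-- The `n`-point Gauss–Legendre quadrature error on the Chebyshev polynomial `T_k`
(`k ∈ ℤ`, `T_{-k} = T_k`). [folklore] -/
private noncomputable def errT (n : ℕ) (k : ℤ) : ℝ :=
  (∫ t in (-1 : ℝ)..1, (T ℝ k).eval t) -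
    ∑ x ∈ gaussLegendreNodes n, gaussLegendreWeight n x * (T ℝ k).eval x

/-- Gauss–Legendre with `n` nodes is exact on `T_k` for `|k| ≤ 2n - 1`. [folklore] -/
private theorem errT_eq_zero {n : ℕ} {k : ℤ} (hk : k.natAbs < 2 * n) : errT n k = 0 := by
  rw [errT, sub_eq_zero]
  exact integral_eq_sum_gaussLegendreWeight_mul (by rwa [Polynomial.Chebyshev.natDegree_T])

/-- `t ∈ Ι (-1) 1 → |t| ≤ 1`. [folklore] -/
private theorem abs_le_one_of_mem_uIoc {t : ℝ} (ht : t ∈ Ι (-1 : ℝ) 1) : |t| ≤ 1 := by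
  rw [Set.uIoc_of_le (by norm_num)] at ht
  exact abs_le.mpr ⟨ht.1.le, ht.2⟩

/-- `|E_n(T_k)| ≤ |∫ T_k| + Σ w_x |T_k(x)| ≤ 2 + 2`. [folklore] -/
private theorem abs_errT_le {n : ℕ} (hn : 1 ≤ n) (k : ℤ) : |errT n k| ≤ 4 := by
  have h1 : |∫ t in (-1 : ℝ)..1, (T ℝ k).eval t| ≤ 2 := by
    have h := intervalIntegral.norm_integral_le_of_norm_le_const (a := (-1 : ℝ)) (b := 1) (C := 1)
      (f := fun t : ℝ => (T ℝ k).eval t) fun t ht => by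
        rw [Real.norm_eq_abs]
        exact abs_eval_T_real_le_one k (abs_le_one_of_mem_uIoc ht)
    rw [Real.norm_eq_abs, show |(1 : ℝ) - (-1)| = 2 by norm_num] at h
    linarith
  have h2 : |∑ x ∈ gaussLegendreNodes n, gaussLegendreWeight n x * (T ℝ k).eval x| ≤ 2 := by
    calc |∑ x ∈ gaussLegendreNodes n, gaussLegendreWeight n x * (T ℝ k).eval x|
        ≤ ∑ x ∈ gaussLegendreNodes n, |gaussLegendreWeight n x * (T ℝ k).eval x| :=
          Finset.abs_sum_le_sum_abs _ _
      _ ≤ ∑ x ∈ gaussLegendreNodes n, gaussLegendreWeight n x := by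
          refine Finset.sum_le_sum fun x hx => ?_
          have hw := gaussLegendreWeight_pos hx
          have hx' := mem_Ioo_of_mem_gaussLegendreNodes hx
          have hT := abs_eval_T_real_le_one k (x := x) (abs_le.mpr ⟨hx'.1.le, hx'.2.le⟩)
          rw [abs_mul, abs_of_pos hw]
          nlinarith
      _ = 2 := sum_gaussLegendreWeight hn
  rw [errT]
  exact (abs_sub _ _).trans (by linarith)

/-- The integrals `∫_0^{2π} e^{∓ikx} g(x) dx` agree for an even `2π`-periodic `g`. [folklore] -/
private theorem integral_exp_mul_neg_eq {g : ℂ → ℂ}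
    (hper : ∀ z : ℂ, g (z + ((2 * π : ℝ) : ℂ)) = g z) (heven : ∀ z : ℂ, g (-z) = g z) (n : ℤ) :
    (∫ x in (0 : ℝ)..2 * π, cexp (-(2 * π * I * ((-n : ℤ) : ℂ) * x / ((2 * π : ℝ) : ℂ))) * g x) =
      ∫ x in (0 : ℝ)..2 * π, cexp (-(2 * π * I * n * x / ((2 * π : ℝ) : ℂ))) * g x := by
  have h2π : ((2 * π : ℝ) : ℂ) ≠ 0 := by exact_mod_cast Real.two_pi_pos.ne'
  have hexp : ∀ (m : ℤ) (y : ℂ),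
      cexp (-(2 * π * I * m * y / ((2 * π : ℝ) : ℂ))) = cexp (-(I * m * y)) := by
    intro m y
    congr 2
    rw [show (2 * π * I * m * y : ℂ) = ((2 * π : ℝ) : ℂ) * (I * m * y) by push_cast; ring,
      mul_div_cancel_left₀ _ h2π]
  have hsub := intervalIntegral.integral_comp_sub_left
    (fun x : ℝ => cexp (-(2 * π * I * n * x / ((2 * π : ℝ) : ℂ))) * g x) (2 * π) (a := 0)
    (b := 2 * π)
  simp only [sub_self, sub_zero] at hsub
  rw [← hsub]
  refine intervalIntegral.integral_congr fun x _ => ?_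
  simp only [hexp]
  have hg : g (((2 * π - x : ℝ) : ℂ)) = g x := by
    rw [show (((2 * π - x : ℝ) : ℂ)) = -(x : ℂ) + ((2 * π : ℝ) : ℂ) by push_cast; ring, hper, heven]
  rw [hg]
  congr 1
  rw [show (-(I * ((-n : ℤ) : ℂ) * (x : ℂ)) : ℂ) =
      -(I * n * ((2 * π - x : ℝ) : ℂ)) + n * (2 * π * I) by push_cast; ring,
    Complex.exp_add, Complex.exp_eq_one_iff.mpr ⟨n, rfl⟩, mul_one]

/-! ### The theorem -/

/-- **Gauss–Legendre quadrature of analytic integrands converges geometrically** (Trefethen 2008,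
Thm. 4.5, eq. (4.14); stated here for the `n`-point rule — Trefethen indexes the rule by `n + 1`
nodes — and with the constant `8` of the "partial proof" given loc. cit., which is valid for every
`n ≥ 1`; Trefethen's sharp constant is `64/15`).  If `f` is analytic in the open Bernstein ellipse
`E_ρ` (`ρ > 1`) and `‖f z‖ ≤ M` there, then
`‖∫_{-1}^{1} f - Σ_{x} w_x f(x)‖ ≤ 8M / ((ρ - 1) ρ^{2n-1})`.
Proof as loc. cit.: expand `f` in its Chebyshev series (the Fourier series of `f (cos θ)`), whose
coefficients satisfy `|a_k| ≤ 2Mρ^{-k}` (Thm. 4.2, (4.7)); the rule is exact on `T_k` for `k < 2n`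
and `|∫ T_k - Σ w_x T_k(x)| ≤ 4` for all `k`. [cite: Trefethen2008, Thm. 4.5 (4.14)] -/
theorem norm_integral_sub_gaussLegendre_le {f : ℂ → ℂ} {ρ M : ℝ} (hρ : 1 < ρ)
    (hf : DifferentiableOn ℂ f (bernsteinEllipse ρ)) (hM : ∀ z ∈ bernsteinEllipse ρ, ‖f z‖ ≤ M)
    {n : ℕ} (hn : 1 ≤ n) :
    ‖(∫ t in (-1 : ℝ)..1, f t) -
        ∑ x ∈ gaussLegendreNodes n, (gaussLegendreWeight n x : ℂ) * f x‖ ≤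
      8 * M / ((ρ - 1) * ρ ^ (2 * n - 1)) := by
  have hρ0 : 0 < ρ := one_pos.trans hρ
  have hM0 : 0 ≤ M :=
    (norm_nonneg _).trans (hM _ (ofReal_mem_bernsteinEllipse hρ (t := 0) (by norm_num)))
  obtain ⟨N, hN⟩ : ∃ N : ℕ, 2 * n = N + 1 := ⟨2 * n - 1, by omega⟩
  rw [show 2 * n - 1 = N by omega]
  -- it suffices to prove the bound for every `r ∈ (1, ρ)` in place of `ρ`
  suffices key : ∀ r : ℝ, 1 < r → r < ρ →
      ‖(∫ t in (-1 : ℝ)..1, f t) -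
          ∑ x ∈ gaussLegendreNodes n, (gaussLegendreWeight n x : ℂ) * f x‖ ≤
        8 * M / ((r - 1) * r ^ N) by
    have hden : (ρ - 1) * ρ ^ N ≠ 0 :=
      mul_ne_zero (sub_ne_zero.mpr hρ.ne') (pow_ne_zero _ hρ0.ne')
    have hcont : ContinuousAt (fun r : ℝ => 8 * M / ((r - 1) * r ^ N)) ρ :=
      ContinuousAt.div continuousAt_const (by fun_prop) hden
    refine ge_of_tendsto (hcont.tendsto.mono_left (nhdsWithin_le_nhds (s := Iio ρ))) ?_
    filter_upwards [Ioo_mem_nhdsLT hρ] with r hr using key r hr.1 hr.2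
  intro r hr1 hrρ
  have hr0 : 0 < r := one_pos.trans hr1
  set a : ℝ := Real.log ρ with ha
  have ha0 : 0 < a := Real.log_pos hρ
  set a' : ℝ := Real.log r with ha'
  have ha'0 : 0 < a' := Real.log_pos hr1
  have ha'a : a' < a := Real.log_lt_log hr0 hrρ
  -- ### Step 1: `g = f ∘ cos` is `2π`-periodic, even, analytic and bounded in `|Im θ| < a`
  set g : ℂ → ℂ := fun z => f (Complex.cos z) with hg
  have hmem : ∀ z : ℂ, |z.im| < a → Complex.cos z ∈ bernsteinEllipse ρ := fun z hz =>
    (cos_mem_bernsteinEllipse_iff hρ z).mpr hz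
  have hgd : DifferentiableOn ℂ g {z : ℂ | |z.im| < a} := fun z hz =>
    ((hf.differentiableAt ((isOpen_bernsteinEllipse ρ).mem_nhds (hmem z hz))).comp z
      (Complex.differentiable_cos z)).differentiableWithinAt
  have hgper : ∀ z : ℂ, g (z + ((2 * π : ℝ) : ℂ)) = g z := by
    intro z
    simp only [hg]
    push_cast
    rw [Complex.cos_add_two_pi]
  have hgM : ∀ z : ℂ, |z.im| < a → ‖g z‖ ≤ M := fun z hz => hM _ (hmem z hz)
  have hgeven : ∀ z : ℂ, g (-z) = g z := fun z => by simp only [hg, Complex.cos_neg]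
  have hgreal : ∀ t : ℝ, t ∈ Icc (-1 : ℝ) 1 → g (Real.arccos t) = f t := by
    intro t ht
    simp only [hg]
    rw [← Complex.ofReal_cos, Real.cos_arccos ht.1 ht.2]
  -- ### Step 2: `g|_ℝ` on the circle `ℝ/2πℤ`; its Fourier (= Chebyshev) coefficients decay
  have h2π : (0 : ℝ) < 2 * π := Real.two_pi_pos
  haveI : Fact ((0 : ℝ) < 2 * π) := ⟨h2π⟩
  set gR : ℝ → ℂ := fun x => g x with hgR
  have hcontR : Continuous gR :=
    hgd.continuousOn.comp_continuous continuous_ofReal fun x => by simpa using ha0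
  let F : C(AddCircle (2 * π), ℂ) :=
    ⟨AddCircle.liftIco (2 * π) 0 gR,
      AddCircle.liftIco_continuous (by simpa [hgR] using (hgper 0).symm) hcontR.continuousOn⟩
  have hFapply : ∀ x : ℝ, x ∈ Ico 0 (2 * π) → F (x : AddCircle (2 * π)) = g x := by
    intro x hx
    show AddCircle.liftIco (2 * π) 0 gR x = gR x
    exact AddCircle.liftIco_coe_apply (by rwa [zero_add])
  set c : ℤ → ℂ := fun k => fourierCoeff F k with hc
  have hcoeff : ∀ k : ℤ, c k = (1 / (2 * π) : ℝ) •
      ∫ x in (0 : ℝ)..2 * π, cexp (-(2 * π * I * k * x / ((2 * π : ℝ) : ℂ))) * g x := by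
    intro k
    simp only [hc]
    rw [fourierCoeff_eq_intervalIntegral F k 0, zero_add]
    congr 1
    refine intervalIntegral.integral_congr_Ioo_of_le h2π.le fun x hx => ?_
    rw [fourier_coe_apply, hFapply x (Ioo_subset_Ico_self hx), smul_eq_mul]
    congr 2
    push_cast
    ring
  have hnorm : ∀ k : ℤ, ‖c k‖ ≤ M * Real.exp (-(2 * π * a' * |(k : ℝ)| / (2 * π))) := by
    intro k
    rw [hcoeff k, norm_smul, Real.norm_of_nonneg (by positivity : (0 : ℝ) ≤ 1 / (2 * π))]
    have h := norm_integral_exp_mul_le h2π hgd hgper hgM k ha'0.le ha'a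
    calc 1 / (2 * π) *
          ‖∫ x in (0 : ℝ)..2 * π, cexp (-(2 * π * I * k * x / ((2 * π : ℝ) : ℂ))) * g x‖
        ≤ 1 / (2 * π) * (2 * π * M * Real.exp (-(2 * π * a' * |(k : ℝ)| / (2 * π)))) :=
          mul_le_mul_of_nonneg_left h (by positivity)
      _ = M * Real.exp (-(2 * π * a' * |(k : ℝ)| / (2 * π))) := by field_simp
  -- the majorant `M q^{|k|}`, `q = e^{-a'} = 1/r`
  set q : ℝ := Real.exp (-(2 * π * a' / (2 * π))) with hq
  have hq0 : 0 < q := Real.exp_pos _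
  have hq1 : q < 1 := Real.exp_lt_one_iff.mpr (by
    have : 0 < 2 * π * a' / (2 * π) := by positivity
    linarith)
  have hqr : q = r⁻¹ := by
    rw [hq, show 2 * π * a' / (2 * π) = a' by field_simp, Real.exp_neg, ha', Real.exp_log hr0]
  have hexpq : ∀ k : ℕ, Real.exp (-(2 * π * a' * k / (2 * π))) = q ^ k := by
    intro k
    rw [hq, ← Real.exp_nat_mul]
    congr 1
    ring
  have hnorm' : ∀ k : ℤ, ‖c k‖ ≤ M * q ^ k.natAbs := by
    intro k
    have habs : ((k.natAbs : ℕ) : ℝ) = |(k : ℝ)| := by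
      rw [← Int.cast_natCast, Int.natCast_natAbs, Int.cast_abs]
    rw [← hexpq, habs]
    exact hnorm k
  have hsumq : Summable fun k : ℤ => M * q ^ k.natAbs := by
    refine Summable.of_add_one_of_neg_add_one ?_ ?_
    · have : (fun k : ℕ => M * q ^ ((k : ℤ) + 1).natAbs) = fun k : ℕ => M * q ^ (k + 1) := by
        funext k
        rw [show ((k : ℤ) + 1).natAbs = k + 1 by omega]
      rw [this]
      exact ((summable_geometric_of_lt_one hq0.le hq1).mul_left (M * q)).congr
        fun k => by ring
    · have : (fun k : ℕ => M * q ^ (-((k : ℤ) + 1)).natAbs) = fun k : ℕ => M * q ^ (k + 1) := by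
        funext k
        rw [show (-((k : ℤ) + 1)).natAbs = k + 1 by omega]
      rw [this]
      exact ((summable_geometric_of_lt_one hq0.le hq1).mul_left (M * q)).congr
        fun k => by ring
  have hsumF : Summable (fourierCoeff F) := Summable.of_norm_bounded hsumq hnorm'
  have hsumC : Summable fun k : ℤ => ‖c k‖ :=
    Summable.of_nonneg_of_le (fun _ => norm_nonneg _) hnorm' hsumq
  -- ### Step 3: `g` is even, so its Fourier series is a cosine (= Chebyshev) series
  have hceven : ∀ k : ℤ, c (-k) = c k := by
    intro k
    rw [hcoeff, hcoeff, integral_exp_mul_neg_eq hgper hgeven k]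
  have hpt : ∀ θ : ℝ, θ ∈ Icc 0 π →
      HasSum (fun k : ℤ => c k * cexp (k * θ * I)) (g θ) := by
    intro θ hθ
    have hx : θ ∈ Ico 0 (2 * π) := ⟨hθ.1, by linarith [hθ.2, Real.pi_pos]⟩
    have h := has_pointwise_sum_fourier_series_of_summable hsumF θ
    rw [hFapply _ hx] at h
    convert h using 2 with k
    rw [fourier_coe_apply, smul_eq_mul]
    congr 2
    push_cast
    field_simp
  have hsym : ∀ θ : ℝ, θ ∈ Icc 0 π →
      HasSum (fun k : ℤ => c k * Complex.cos (k * θ)) (g θ) := by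
    intro θ hθ
    have h1 := hpt θ hθ
    have h2 : HasSum (fun k : ℤ => c k * cexp (-(k * θ) * I)) (g θ) := by
      have h := (Equiv.neg ℤ).hasSum_iff.mpr h1
      convert h using 2 with k
      simp only [Function.comp_apply, Equiv.neg_apply, hceven]
      push_cast
      ring_nf
    have h3 := (h1.add h2).div_const 2
    rw [← two_mul, mul_div_cancel_left₀ _ two_ne_zero] at h3
    have e : ∀ k : ℤ, (c k * cexp (k * θ * I) + c k * cexp (-(k * θ) * I)) / 2 =
        c k * Complex.cos (k * θ) := fun k => by
      rw [← mul_add, ← Complex.two_cos]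
      ring
    simp only [e] at h3
    exact h3
  -- ### Step 4: the Chebyshev series of `f` on `[-1, 1]`
  have hcheb : ∀ t : ℝ, t ∈ Icc (-1 : ℝ) 1 →
      HasSum (fun k : ℤ => c k * (((T ℝ k).eval t : ℝ) : ℂ)) (f t) := by
    intro t ht
    have hθ : Real.arccos t ∈ Icc 0 π := ⟨Real.arccos_nonneg t, Real.arccos_le_pi t⟩
    have h := hsym (Real.arccos t) hθ
    rw [hgreal t ht] at h
    convert h using 2 with k
    congr 1
    conv_lhs => rw [← Real.cos_arccos ht.1 ht.2]
    rw [Polynomial.Chebyshev.T_real_cos, Complex.ofReal_cos]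
    push_cast
    ring_nf
  -- ### Step 5: integrate termwise (dominated convergence) and evaluate termwise at the nodes
  have hInt : HasSum (fun k : ℤ => c k * (((∫ t in (-1 : ℝ)..1, (T ℝ k).eval t : ℝ) : ℂ)))
      (∫ t in (-1 : ℝ)..1, f t) := by
    have h := intervalIntegral.hasSum_integral_of_dominated_convergence
      (F := fun (k : ℤ) (t : ℝ) => c k * (((T ℝ k).eval t : ℝ) : ℂ)) (f := fun t : ℝ => f t)
      (μ := volume) (a := (-1 : ℝ)) (b := 1) (fun k _ => ‖c k‖) (fun k => ?_) (fun k => ?_)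
      ?_ ?_ ?_
    · have e : ∀ k : ℤ, (∫ t in (-1 : ℝ)..1, c k * (((T ℝ k).eval t : ℝ) : ℂ)) =
          c k * (((∫ t in (-1 : ℝ)..1, (T ℝ k).eval t : ℝ) : ℂ)) := fun k => by
        rw [intervalIntegral.integral_const_mul, intervalIntegral.integral_ofReal]
      simp only [e] at h
      exact h
    · exact (continuous_const.mul
        (Complex.continuous_ofReal.comp (Polynomial.continuous _))).aestronglyMeasurable
    · exact ae_of_all _ fun t ht => by
        rw [norm_mul, Complex.norm_real, Real.norm_eq_abs]
        exact mul_le_of_le_one_right (norm_nonneg _)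
          (abs_eval_T_real_le_one k (abs_le_one_of_mem_uIoc ht))
    · exact ae_of_all _ fun t _ => hsumC
    · exact intervalIntegrable_const
    · exact ae_of_all _ fun t ht => by
        rw [Set.uIoc_of_le (by norm_num)] at ht
        exact hcheb t ⟨ht.1.le, ht.2⟩
  have hNode : HasSum (fun k : ℤ => c k *
      (((∑ x ∈ gaussLegendreNodes n, gaussLegendreWeight n x * (T ℝ k).eval x : ℝ) : ℂ)))
      (∑ x ∈ gaussLegendreNodes n, (gaussLegendreWeight n x : ℂ) * f x) := by
    have h := hasSum_sum fun x (hx : x ∈ gaussLegendreNodes n) =>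
      (hcheb x (Ioo_subset_Icc_self (mem_Ioo_of_mem_gaussLegendreNodes hx))).mul_left
        (gaussLegendreWeight n x : ℂ)
    have e : ∀ k : ℤ, ∑ x ∈ gaussLegendreNodes n,
        (gaussLegendreWeight n x : ℂ) * (c k * (((T ℝ k).eval x : ℝ) : ℂ)) =
          c k * (((∑ x ∈ gaussLegendreNodes n,
            gaussLegendreWeight n x * (T ℝ k).eval x : ℝ) : ℂ)) := fun k => by
      push_cast
      rw [Finset.mul_sum]
      exact Finset.sum_congr rfl fun x _ => by ring
    simp only [e] at h
    exact h
  have hErr : HasSum (fun k : ℤ => c k * (errT n k : ℂ))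
      ((∫ t in (-1 : ℝ)..1, f t) -
        ∑ x ∈ gaussLegendreNodes n, (gaussLegendreWeight n x : ℂ) * f x) := by
    have h := hInt.sub hNode
    have e : ∀ k : ℤ, c k * (((∫ t in (-1 : ℝ)..1, (T ℝ k).eval t : ℝ) : ℂ)) -
        c k * (((∑ x ∈ gaussLegendreNodes n, gaussLegendreWeight n x * (T ℝ k).eval x : ℝ) : ℂ)) =
          c k * (errT n k : ℂ) := fun k => by
      rw [errT]
      push_cast
      ring
    simp only [e] at h
    exact h
  -- ### Step 6: the terms `|k| < 2n` vanish; compress them out and bound the two tails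
  set s : ℤ → ℂ := fun k => c k * (errT n k : ℂ) with hs
  have hs0 : ∀ k : ℤ, k.natAbs < 2 * n → s k = 0 := fun k hk => by
    simp only [hs, errT_eq_zero hk, Complex.ofReal_zero, mul_zero]
  have hsle : ∀ k : ℤ, ‖s k‖ ≤ 4 * M * q ^ k.natAbs := fun k => by
    simp only [hs]
    rw [norm_mul, Complex.norm_real, Real.norm_eq_abs]
    calc ‖c k‖ * |errT n k| ≤ M * q ^ k.natAbs * 4 :=
          mul_le_mul (hnorm' k) (abs_errT_le hn k) (abs_nonneg _) (by positivity)
      _ = 4 * M * q ^ k.natAbs := by ring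
  set e : ℤ → ℤ := fun m => if 0 < m then m + N else if m < 0 then m - N else 0 with he
  have hinj : Function.Injective e := by
    intro m₁ m₂ h
    simp only [he] at h
    split_ifs at h <;> omega
  have hrange : ∀ k : ℤ, k ∉ Set.range e → s k = 0 := by
    intro k hk
    apply hs0
    by_contra hge
    push Not at hge
    apply hk
    rcases lt_or_ge k 0 with hlt | hge'
    · exact ⟨k + N, by simp only [he]; split_ifs <;> omega⟩
    · exact ⟨k - N, by simp only [he]; split_ifs <;> omega⟩
  set u : ℤ → ℂ := s ∘ e with hu
  have hU : HasSum u ((∫ t in (-1 : ℝ)..1, f t) -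
      ∑ x ∈ gaussLegendreNodes n, (gaussLegendreWeight n x : ℂ) * f x) :=
    (hinj.hasSum_iff hrange).mpr hErr
  have hu0 : u 0 = 0 := by
    simp only [hu, Function.comp_apply, he, lt_irrefl, if_false]
    exact hs0 0 (by omega)
  have hupos : ∀ m : ℕ, u ((m : ℤ) + 1) = s ((m : ℤ) + 1 + N) := by
    intro m
    simp only [hu, Function.comp_apply, he]
    split_ifs <;> first | rfl | omega
  have huneg : ∀ m : ℕ, u (-((m : ℤ) + 1)) = s (-((m : ℤ) + 1) - N) := by
    intro m
    simp only [hu, Function.comp_apply, he]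
    split_ifs <;> first | rfl | omega
  have htail : ∀ m : ℕ, ‖u ((m : ℤ) + 1)‖ ≤ 4 * M * q ^ (2 * n) * q ^ m ∧
      ‖u (-((m : ℤ) + 1))‖ ≤ 4 * M * q ^ (2 * n) * q ^ m := by
    intro m
    have e1 : ((m : ℤ) + 1 + N).natAbs = 2 * n + m := by omega
    have e2 : (-((m : ℤ) + 1) - N).natAbs = 2 * n + m := by omega
    rw [hupos, huneg]
    refine ⟨(hsle _).trans (le_of_eq ?_), (hsle _).trans (le_of_eq ?_)⟩
    · rw [e1, pow_add]
      ring
    · rw [e2, pow_add]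
      ring
  have hgeo : HasSum (fun m : ℕ => 4 * M * q ^ (2 * n) * q ^ m)
      (4 * M * q ^ (2 * n) / (1 - q)) := by
    rw [div_eq_mul_inv]
    exact (hasSum_geometric_of_lt_one hq0.le hq1).mul_left _
  have hA : Summable fun m : ℕ => u ((m : ℤ) + 1) :=
    Summable.of_norm_bounded hgeo.summable fun m => (htail m).1
  have hB : Summable fun m : ℕ => u (-((m : ℤ) + 1)) :=
    Summable.of_norm_bounded hgeo.summable fun m => (htail m).2
  have hAle : ‖∑' m : ℕ, u ((m : ℤ) + 1)‖ ≤ 4 * M * q ^ (2 * n) / (1 - q) :=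
    tsum_of_norm_bounded hgeo fun m => (htail m).1
  have hBle : ‖∑' m : ℕ, u (-((m : ℤ) + 1))‖ ≤ 4 * M * q ^ (2 * n) / (1 - q) :=
    tsum_of_norm_bounded hgeo fun m => (htail m).2
  have hsplit := HasSum.of_add_one_of_neg_add_one hA.hasSum hB.hasSum
  have hval : (∫ t in (-1 : ℝ)..1, f t) -
      ∑ x ∈ gaussLegendreNodes n, (gaussLegendreWeight n x : ℂ) * f x =
        (∑' m : ℕ, u ((m : ℤ) + 1)) + u 0 + ∑' m : ℕ, u (-((m : ℤ) + 1)) := hU.unique hsplit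
  -- ### Step 7: assemble; `q = 1/r`
  have hfin : 4 * M * q ^ (2 * n) / (1 - q) + 4 * M * q ^ (2 * n) / (1 - q) =
      8 * M / ((r - 1) * r ^ N) := by
    rw [hqr, hN]
    have hr0' : r ≠ 0 := hr0.ne'
    have hr1' : r - 1 ≠ 0 := sub_ne_zero.mpr hr1.ne'
    have h1 : (1 : ℝ) - r⁻¹ = (r - 1) / r := by field_simp
    rw [h1, inv_pow, pow_succ]
    field_simp
    ring
  rw [hval, hu0, add_zero]
  calc ‖(∑' m : ℕ, u ((m : ℤ) + 1)) + ∑' m : ℕ, u (-((m : ℤ) + 1))‖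
      ≤ 4 * M * q ^ (2 * n) / (1 - q) + 4 * M * q ^ (2 * n) / (1 - q) :=
        (norm_add_le _ _).trans (add_le_add hAle hBle)
    _ = 8 * M / ((r - 1) * r ^ N) := hfin

/-- **Gauss–Legendre quadrature of analytic integrands on `[a, b]`** (transport of
`norm_integral_sub_gaussLegendre_le` by `x ↦ (b-a)/2·x + (a+b)/2`): if `f` is analytic in the open
ellipse with foci `a`, `b` and semi-axis sum `ρ (b-a)/2`, i.e. in
`{z : |z - a| + |z - b| < (ρ + ρ⁻¹)(b - a)/2}` (`ρ > 1`), and `‖f z‖ ≤ M` there, then the `n`-point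
rule on `[a, b]` satisfies `‖∫_a^b f - Σ_x (b-a)/2 · w_x f((b-a)/2·x + (a+b)/2)‖ ≤
(b-a)/2 · 8M / ((ρ - 1) ρ^{2n-1})`. [cite: Trefethen2008, Thm. 4.5 (4.14)] -/
theorem norm_integral_sub_gaussLegendre_le_interval {f : ℂ → ℂ} {ρ M a b : ℝ} (hρ : 1 < ρ)
    (hab : a < b)
    (hf : DifferentiableOn ℂ f {z : ℂ | ‖z - a‖ + ‖z - b‖ < (ρ + ρ⁻¹) * ((b - a) / 2)})
    (hM : ∀ z : ℂ, ‖z - a‖ + ‖z - b‖ < (ρ + ρ⁻¹) * ((b - a) / 2) → ‖f z‖ ≤ M)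
    {n : ℕ} (hn : 1 ≤ n) :
    ‖(∫ t in a..b, f t) - ∑ x ∈ gaussLegendreNodes n,
        ((b - a) / 2 * gaussLegendreWeight n x : ℂ) * f ((b - a) / 2 * x + (a + b) / 2)‖ ≤
      (b - a) / 2 * (8 * M / ((ρ - 1) * ρ ^ (2 * n - 1))) := by
  have hL0 : 0 < (b - a) / 2 := by linarith
  have hLc : (((b - a) / 2 : ℝ) : ℂ) ≠ 0 := by exact_mod_cast hL0.ne'
  set g : ℂ → ℂ := fun z => f ((((b - a) / 2 : ℝ) : ℂ) * z + (((a + b) / 2 : ℝ) : ℂ)) with hg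
  have hmaps : ∀ z : ℂ, z ∈ bernsteinEllipse ρ →
      ‖(((b - a) / 2 : ℝ) : ℂ) * z + (((a + b) / 2 : ℝ) : ℂ) - a‖ +
        ‖(((b - a) / 2 : ℝ) : ℂ) * z + (((a + b) / 2 : ℝ) : ℂ) - b‖ <
          (ρ + ρ⁻¹) * ((b - a) / 2) := by
    intro z hz
    have hz' : ‖z - 1‖ + ‖z + 1‖ < ρ + ρ⁻¹ := hz
    have e1 : (((b - a) / 2 : ℝ) : ℂ) * z + (((a + b) / 2 : ℝ) : ℂ) - a =
        (((b - a) / 2 : ℝ) : ℂ) * (z + 1) := by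
      push_cast
      ring
    have e2 : (((b - a) / 2 : ℝ) : ℂ) * z + (((a + b) / 2 : ℝ) : ℂ) - b =
        (((b - a) / 2 : ℝ) : ℂ) * (z - 1) := by
      push_cast
      ring
    rw [e1, e2, norm_mul, norm_mul, Complex.norm_real, Real.norm_of_nonneg hL0.le]
    nlinarith
  have hgd : DifferentiableOn ℂ g (bernsteinEllipse ρ) :=
    hf.comp (by fun_prop) fun z hz => hmaps z hz
  have hgM : ∀ z ∈ bernsteinEllipse ρ, ‖g z‖ ≤ M := fun z hz => hM _ (hmaps z hz)
  have key := norm_integral_sub_gaussLegendre_le hρ hgd hgM hn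
  -- the affine change of variables in the integral and in the sum
  have hint : (∫ t in a..b, f t) = (((b - a) / 2 : ℝ) : ℂ) * ∫ t in (-1 : ℝ)..1, g t := by
    have h := intervalIntegral.integral_comp_mul_add (fun t : ℝ => f t) hL0.ne' ((a + b) / 2)
      (a := -1) (b := 1)
    beta_reduce at h
    rw [show (b - a) / 2 * (-1 : ℝ) + (a + b) / 2 = a by ring,
      show (b - a) / 2 * (1 : ℝ) + (a + b) / 2 = b by ring] at h
    have hg' : (fun t : ℝ => g t) = fun t : ℝ => f (((b - a) / 2 * t + (a + b) / 2 : ℝ) : ℂ) := by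
      funext t
      simp only [hg]
      push_cast
      ring_nf
    rw [hg', h, Complex.real_smul, Complex.ofReal_inv, mul_inv_cancel_left₀ hLc]
  have hsum : ∑ x ∈ gaussLegendreNodes n,
      ((b - a) / 2 * gaussLegendreWeight n x : ℂ) * f ((b - a) / 2 * x + (a + b) / 2) =
        (((b - a) / 2 : ℝ) : ℂ) *
          ∑ x ∈ gaussLegendreNodes n, (gaussLegendreWeight n x : ℂ) * g x := by
    rw [Finset.mul_sum]
    refine Finset.sum_congr rfl fun x _ => ?_
    simp only [hg]
    push_cast
    ring_nf
  rw [hint, hsum, ← mul_sub, norm_mul, Complex.norm_real, Real.norm_of_nonneg hL0.le]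
  exact mul_le_mul_of_nonneg_left key hL0.le

end Literature.Analysis.Quadrature
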